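import Summits.HodgeConjecture.HodgeConjecture.Theses.EndoscopicMiddleDegree
import Literature.AlgebraicGeometry.HodgeTheory.ComplexGysinCorrespondence
import Literature.AlgebraicGeometry.HodgeTheory.RationalClassesIndependent
import Literature.AlgebraicGeometry.HodgeTheory.SupportedClassesRationalProofs

/-!
# `IsotypicMiddleClassesAlgebraic` (stmt-HodgeConjecture-14301) · Negative · the rationality of `c` is decorative

Negative knowledge (a tightness lemma) for the crux `EndoscopicMiddleDegree.IsotypicMiddleClassesAlgebraic`
(route EndoscopicMiddleDegree, rank 3): the hypothesis `IsRationalClass c` on the fixed class adds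
nothing — the crux for RATIONAL fixed classes implies it for ALL complex fixed classes
(`mem_algebraicClasses_of_crux_of_fixed`), i.e. under the crux the whole fixed subspace
`ker (P_γ - 1)` of an admissible correspondence action `P_γ = corrAction μ hX hX rfl γ` is algebraic
(`ker_le_algebraicClasses_of_crux`). Mechanism (pure linear algebra over the tree's rational
lattice, valid for any space whose rational classes span): `Q = P - 1` maps rational classes to
rational classes, the rational classes span `H^{2n}(X(ℂ); ℂ)`
(`span_isRationalClass_eq_top_of_isSmoothProjective_holds`), a rational class in the span of an
independent rational family has rational coordinates (`exists_rat_coords`, from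
`linearIndependent_iff_of_isRationalClass`), complex relations among rational classes survive every
`ℚ`-linear functional `ℂ → ℚ` (`sum_smul_eq_zero_of_dual`), hence `ker Q` is spanned by rational
elements of `ker Q` (`mem_span_rational_ker`). So the honest prover target is
`ker (P - 1) ≤ algebraicClasses X (m+1)`. Disprover's work file:
`Cruxes/IsotypicMiddleClassesAlgebraic/Disproof.lean` (F3(d)).
Refuter seat refuter-cdisprove-stmt-HodgeConjecture-14301-0 (cdisprove cycle 1), 2026-08-16.
-/

noncomputable section

-- The mandated namespace `Summit.<P>.<Sub>.Theorems.…` repeats `HodgeConjecture` (single-conjunct summit).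
set_option linter.dupNamespace false

namespace Summit.HodgeConjecture.HodgeConjecture.Theorems.IsotypicMiddleClassesAlgebraic.Negative.RationalFixed

open CategoryTheory MonoidalCategory CartesianMonoidalCategory Submodule
open Literature.AlgebraicGeometry Literature.AlgebraicGeometry.HodgeTheory
  Literature.AlgebraicGeometry.ShimuraVarieties Literature.AlgebraicTopology.SingularHomology
open Summit.HodgeConjecture.HodgeConjecture.Theses.EndoscopicMiddleDegree (IsotypicMiddleClassesAlgebraic)

section RationalLattice

universe u
variable {Y : Type u} [TopologicalSpace Y] {k : ℕ}



/-- Rational classes are closed under negation. [cite: HatcherAT2002, §3.1] -/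
theorem isRationalClass_neg {c : singularCohomology ℂ ℂ Y k} (hc : IsRationalClass c) :
    IsRationalClass (-c) := by
  have h := hc.smul (-1)
  rwa [Rat.cast_neg, Rat.cast_one, neg_one_smul] at h

/-- Rational classes are closed under subtraction. [cite: HatcherAT2002, §3.1] -/
theorem isRationalClass_sub {c c' : singularCohomology ℂ ℂ Y k} (hc : IsRationalClass c)
    (hc' : IsRationalClass c') : IsRationalClass (c - c') := by
  rw [sub_eq_add_neg]; exact hc.add (isRationalClass_neg hc')

/-- Finite `ℚ`-linear combinations of rational classes are rational. [cite: HatcherAT2002, §3.1] -/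
theorem isRationalClass_sum_smul {ι : Type*} (s : Finset ι) (q : ι → ℚ)
    (b : ι → singularCohomology ℂ ℂ Y k) (hb : ∀ i ∈ s, IsRationalClass (b i)) :
    IsRationalClass (∑ i ∈ s, ((q i : ℚ) : ℂ) • b i) := by
  classical
  induction s using Finset.induction_on with
  | empty => rw [Finset.sum_empty]; exact IsRationalClass.zero
  | insert a s ha ih =>
    rw [Finset.sum_insert ha]
    exact ((hb a (Finset.mem_insert_self a s)).smul (q a)).add
      (ih fun i hi ↦ hb i (Finset.mem_insert_of_mem hi))

/-- **Rational coordinates.** A rational class lying in the complex span of a finite `ℂ`-independent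
family of rational classes is a RATIONAL combination of them (the family plus the class is
`ℂ`-dependent, hence satisfies a non-trivial rational relation by
`linearIndependent_iff_of_isRationalClass`, whose coefficient on the class is non-zero).
[cite: VoisinHodgeI2002, §7.1.1] [cite: HatcherAT2002, §3.1 Thm. 3.2 and p. 198] -/
theorem exists_rat_coords {ι : Type*} [Fintype ι] {b : ι → singularCohomology ℂ ℂ Y k}
    (hb : ∀ j, IsRationalClass (b j)) (hind : LinearIndependent ℂ b)
    {x : singularCohomology ℂ ℂ Y k} (hx : IsRationalClass x) (hxs : x ∈ span ℂ (Set.range b)) :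
    ∃ q : ι → ℚ, x = ∑ j, ((q j : ℚ) : ℂ) • b j := by
  classical
  set b' : Option ι → singularCohomology ℂ ℂ Y k := fun o ↦ o.elim x b with hb'def
  have hb' : ∀ o, IsRationalClass (b' o) := by
    rintro (_ | j)
    · exact hx
    · exact hb j
  have hcomp : (b' ∘ ((↑) : ι → Option ι)) = b := by
    funext j; rfl
  have hdep : ¬ LinearIndependent ℂ b' := by
    intro h
    have h2 := (linearIndependent_option.1 h).2
    rw [hcomp] at h2
    exact h2 hxs
  rw [linearIndependent_iff_of_isRationalClass hb'] at hdep
  push Not at hdep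
  obtain ⟨q, hq, hq0⟩ := hdep
  rw [Fintype.sum_option] at hq
  have hqn : q none ≠ 0 := by
    intro h0
    apply hq0
    have hrel : ∑ j, ((q (some j) : ℚ) : ℂ) • b j = 0 := by
      simpa [h0, hb'def] using hq
    have hz : ∀ j, q (some j) = 0 := fun j ↦ by
      have := Fintype.linearIndependent_iff.1 hind (fun j ↦ ((q (some j) : ℚ) : ℂ)) hrel j
      exact_mod_cast this
    funext o
    cases o with
    | none => exact h0
    | some j => exact hz j
  refine ⟨fun j ↦ -(q (some j)) / q none, ?_⟩
  have hx' : ((q none : ℚ) : ℂ) • x = -∑ j, ((q (some j) : ℚ) : ℂ) • b j := by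
    rw [eq_neg_iff_add_eq_zero]
    simpa [hb'def] using hq
  have hqnC : ((q none : ℚ) : ℂ) ≠ 0 := by exact_mod_cast hqn
  calc x = ((q none : ℚ) : ℂ)⁻¹ • (((q none : ℚ) : ℂ) • x) := by
        rw [smul_smul, inv_mul_cancel₀ hqnC, one_smul]
    _ = ∑ j, (((-(q (some j)) / q none : ℚ) : ℂ)) • b j := by
        rw [hx', ← Finset.sum_neg_distrib, Finset.smul_sum]
        refine Finset.sum_congr rfl fun j _ ↦ ?_
        rw [← neg_smul, smul_smul]
        congr 1
        push_cast
        ring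

/-- **Complex relations among rational classes survive every `ℚ`-linear functional `φ : ℂ → ℚ`**:
`Σ λᵢ yᵢ = 0` with `yᵢ` rational implies `Σ φ(λᵢ) yᵢ = 0` (expand the `yᵢ` rationally on an
independent rational family; the complex coefficients vanish; apply `φ`).
[cite: VoisinHodgeI2002, §7.1.1] -/
theorem sum_smul_eq_zero_of_dual {ι : Type*} (s : Finset ι) (y : ι → singularCohomology ℂ ℂ Y k)
    (hy : ∀ i ∈ s, IsRationalClass (y i)) (lam : ι → ℂ) (h : ∑ i ∈ s, lam i • y i = 0)
    (φ : ℂ →ₗ[ℚ] ℚ) : ∑ i ∈ s, ((φ (lam i) : ℚ) : ℂ) • y i = 0 := by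
  classical
  -- an independent rational family `b` spanning the `y i`, `i ∈ s`
  set S : Finset (singularCohomology ℂ ℂ Y k) := s.image y with hSdef
  obtain ⟨t, hts, -, htspan, htind⟩ :=
    Submodule.exists_finset_span_eq_linearIndepOn ℂ (S : Set (singularCohomology ℂ ℂ Y k))
  set b : ↥(↑t : Set (singularCohomology ℂ ℂ Y k)) → singularCohomology ℂ ℂ Y k :=
    Subtype.val with hbdef
  have hb : ∀ j, IsRationalClass (b j) := by
    rintro ⟨x, hx⟩
    obtain ⟨i, hi, rfl⟩ := Finset.mem_image.1 (hts hx)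
    exact hy i hi
  have hind : LinearIndependent ℂ b := htind
  have hrange : Set.range b = (t : Set _) := Subtype.range_coe
  -- rational coordinates of each `y i` in `b`
  have hyi : ∀ i ∈ s, ∃ q : ↥(↑t : Set (singularCohomology ℂ ℂ Y k)) → ℚ,
      y i = ∑ j, ((q j : ℚ) : ℂ) • b j := by
    intro i hi
    refine exists_rat_coords hb hind (hy i hi) ?_
    rw [hrange, htspan]
    exact subset_span (Finset.mem_image_of_mem y hi)
  choose! a ha using hyi
  -- the complex coefficients of the relation vanish
  have hcoef : ∀ j, ∑ i ∈ s, lam i * ((a i j : ℚ) : ℂ) = 0 := by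
    have hsum : ∑ j, (∑ i ∈ s, lam i * ((a i j : ℚ) : ℂ)) • b j = 0 := by
      rw [← h]
      simp_rw [Finset.sum_smul, mul_smul]
      rw [Finset.sum_comm]
      refine Finset.sum_congr rfl fun i hi ↦ ?_
      rw [← Finset.smul_sum, ← ha i hi]
    exact fun j ↦ Fintype.linearIndependent_iff.1 hind _ hsum j
  -- apply `φ`
  have hcoefφ : ∀ j, ∑ i ∈ s, φ (lam i) * a i j = 0 := by
    intro j
    have h1 : φ (∑ i ∈ s, lam i * ((a i j : ℚ) : ℂ)) = ∑ i ∈ s, φ (lam i) * a i j := by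
      rw [map_sum]
      refine Finset.sum_congr rfl fun i _ ↦ ?_
      rw [show lam i * ((a i j : ℚ) : ℂ) = (a i j : ℚ) • lam i by
        rw [Rat.smul_def, mul_comm], map_smul, smul_eq_mul, mul_comm]
    rw [← h1, hcoef j, map_zero]
  -- reassemble
  calc ∑ i ∈ s, ((φ (lam i) : ℚ) : ℂ) • y i
      = ∑ i ∈ s, ((φ (lam i) : ℚ) : ℂ) • ∑ j, ((a i j : ℚ) : ℂ) • b j :=
        Finset.sum_congr rfl fun i hi ↦ by rw [← ha i hi]
    _ = ∑ j, (∑ i ∈ s, ((φ (lam i) : ℚ) : ℂ) * ((a i j : ℚ) : ℂ)) • b j := by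
        simp_rw [Finset.smul_sum, smul_smul, Finset.sum_smul]
        rw [Finset.sum_comm]
    _ = 0 := by
        refine Finset.sum_eq_zero fun j _ ↦ ?_
        rw [show (∑ i ∈ s, ((φ (lam i) : ℚ) : ℂ) * ((a i j : ℚ) : ℂ)) =
          (((∑ i ∈ s, φ (lam i) * a i j : ℚ)) : ℂ) by push_cast; rfl, hcoefφ j]
        simp




/-- **The kernel of a rational endomorphism is spanned by rational kernel classes.** If the rational
classes span `Hᵏ(Y; ℂ)` and the `ℂ`-linear `Q` maps rational classes to rational classes, every
`c ∈ ker Q` is a complex combination of RATIONAL elements of `ker Q`: write `c = Σ_t f(t) t` on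
rational `t`, read the coefficients `f(t)` through `ℚ`-linear coordinate functionals `φ_u` of their
`ℚ`-span, and set `c_u = Σ_t φ_u(f t) t` — rational, in `ker Q` by `sum_smul_eq_zero_of_dual`, and
`c = Σ_u e_u c_u`. (`Ker Q = (Ker Q_ℚ) ⊗ ℂ`, flatness of `ℂ/ℚ`, with no finiteness of `H` used.)
[cite: VoisinHodgeI2002, §7.1.1] -/
theorem mem_span_rational_ker (hspan : span ℂ {x : singularCohomology ℂ ℂ Y k | IsRationalClass x} = ⊤)
    (Q : singularCohomology ℂ ℂ Y k →ₗ[ℂ] singularCohomology ℂ ℂ Y k)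
    (hQ : ∀ β, IsRationalClass β → IsRationalClass (Q β)) {c : singularCohomology ℂ ℂ Y k}
    (hc : Q c = 0) :
    c ∈ span ℂ {x : singularCohomology ℂ ℂ Y k | IsRationalClass x ∧ Q x = 0} := by
  classical
  -- write `c` on finitely many rational classes: `c = Σ_{t ∈ T} f t • t`
  have hc' : c ∈ span ℂ {x : singularCohomology ℂ ℂ Y k | IsRationalClass x} := by
    rw [hspan]; exact mem_top
  obtain ⟨T, hTR, hcT⟩ := mem_span_finite_of_mem_span hc'
  obtain ⟨f, -, hf⟩ := mem_span_finset.1 hcT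
  -- the relation `Σ_t f t • Q t = 0`
  have hrel : ∑ t ∈ T, f t • Q t = 0 := by
    have h1 := congrArg Q hf
    rw [map_sum, hc] at h1
    simpa only [map_smul] using h1
  -- coordinates of the coefficients `f t` over `ℚ`: `E = span_ℚ {f t}` with a basis, and
  -- `ℚ`-linear functionals `φ_u : ℂ → ℚ` reading them off
  set E : Submodule ℚ ℂ := span ℚ (↑(T.image f) : Set ℂ) with hEdef
  haveI : Module.Finite ℚ E := Module.Finite.span_of_finite ℚ (Finset.finite_toSet _)
  set bE := Module.finBasis ℚ E with hbEdef
  obtain ⟨g, hg⟩ := E.subtype.exists_leftInverse_of_injective E.ker_subtype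
  have hgE : ∀ e : E, g (e : ℂ) = e := fun e ↦ LinearMap.congr_fun hg e
  set φ : Fin (Module.finrank ℚ E) → ℂ →ₗ[ℚ] ℚ := fun u ↦ (bE.coord u).comp g with hφdef
  have hft : ∀ t ∈ T, f t = ∑ u, ((φ u (f t) : ℚ) : ℂ) * (bE u : ℂ) := by
    intro t ht
    have hmem : f t ∈ E := subset_span (Finset.mem_coe.2 (Finset.mem_image_of_mem f ht))
    have h1 := bE.sum_repr ⟨f t, hmem⟩
    have h2 := congrArg (Submodule.subtype E) h1
    rw [map_sum] at h2
    simp only [Submodule.subtype_apply, SetLike.val_smul] at h2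
    have hφu : ∀ u, φ u (f t) = bE.repr ⟨f t, hmem⟩ u := fun u ↦ by
      change (bE.coord u) (g ((⟨f t, hmem⟩ : E) : ℂ)) = _
      rw [hgE]
      rfl
    calc f t = ∑ u, (bE.repr ⟨f t, hmem⟩ u) • ((bE u : E) : ℂ) := h2.symm
      _ = ∑ u, ((φ u (f t) : ℚ) : ℂ) * (bE u : ℂ) :=
          Finset.sum_congr rfl fun u _ ↦ by rw [hφu, Rat.smul_def]
  -- the rational kernel classes `c_u := Σ_t φ_u(f t) • t`
  set cu : Fin (Module.finrank ℚ E) → singularCohomology ℂ ℂ Y k :=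
    fun u ↦ ∑ t ∈ T, ((φ u (f t) : ℚ) : ℂ) • t with hcudef
  have hcu_rat : ∀ u, IsRationalClass (cu u) := fun u ↦
    isRationalClass_sum_smul T (fun t ↦ φ u (f t)) id fun t ht ↦ hTR ht
  have hcu_ker : ∀ u, Q (cu u) = 0 := by
    intro u
    rw [hcudef]
    simp only [map_sum, map_smul]
    exact sum_smul_eq_zero_of_dual T (fun t ↦ Q t) (fun t ht ↦ hQ t (hTR ht)) f hrel (φ u)
  -- `c = Σ_u e_u • c_u`
  have hc_eq : c = ∑ u, (bE u : ℂ) • cu u := by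
    rw [← hf]
    calc ∑ t ∈ T, f t • t = ∑ t ∈ T, (∑ u, ((φ u (f t) : ℚ) : ℂ) * (bE u : ℂ)) • t :=
          Finset.sum_congr rfl fun t ht ↦ by rw [← hft t ht]
      _ = ∑ u, (bE u : ℂ) • cu u := by
          simp_rw [hcudef, Finset.sum_smul, Finset.smul_sum, smul_smul]
          rw [Finset.sum_comm]
          refine Finset.sum_congr rfl fun u _ ↦ Finset.sum_congr rfl fun t _ ↦ ?_
          rw [mul_comm]
  rw [hc_eq]
  exact sum_mem fun u _ ↦ smul_mem _ _ (subset_span ⟨hcu_rat u, hcu_ker u⟩)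


end RationalLattice

variable {m : ℕ} {X : Motives.SchemeOver ℂ}

/-- **The crux for rational fixed classes gives it for ALL fixed classes.** Under the crux, for an
admissible `P = corrAction μ hX hX rfl γ` (algebraic `γ`, rationality-preserving, `(n,n)`-valued) on a
datum `X`, `m ∈ {1,2}`, EVERY complex class `c` with `P c = c` is algebraic: `IsRationalClass c` is a
decorative hypothesis of the crux. [cite: VoisinHodgeI2002, §7.1.1] -/
theorem mem_algebraicClasses_of_crux_of_fixed (h : IsotypicMiddleClassesAlgebraic)
    (μ : OrientationFamily) (hμ : μ.HasPoincareDuality) (m : ℕ) (X : Motives.SchemeOver ℂ)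
    (D : UnitaryBallQuotientDatum (2 * (m + 1)) X) (h1 : 1 ≤ m) (h2 : m ≤ 2)
    (γ : complexBetti (X ⊗ X) (2 * (2 * (m + 1)))) (hγ : γ ∈ algebraicClasses (X ⊗ X) (2 * (m + 1)))
    (hrat : ∀ β, IsRationalClass β → IsRationalClass
      (corrAction μ D.isSmoothProjective D.isSmoothProjective
        (rfl : 2 * (m + 1) + 2 * (2 * (m + 1)) = 2 * (m + 1) + 2 * (2 * (m + 1))) γ β))
    (hhodge : ∀ β, IsOfHodgeType (2 * (m + 1)) X (2 * (m + 1)) (m + 1) (m + 1)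
      (corrAction μ D.isSmoothProjective D.isSmoothProjective
        (rfl : 2 * (m + 1) + 2 * (2 * (m + 1)) = 2 * (m + 1) + 2 * (2 * (m + 1))) γ β))
    (c : complexBetti X (2 * (m + 1)))
    (hc : corrAction μ D.isSmoothProjective D.isSmoothProjective
      (rfl : 2 * (m + 1) + 2 * (2 * (m + 1)) = 2 * (m + 1) + 2 * (2 * (m + 1))) γ c = c) :
    c ∈ algebraicClasses X (m + 1) := by
  set P : complexBetti X (2 * (m + 1)) →ₗ[ℂ] complexBetti X (2 * (m + 1)) :=
    corrAction μ D.isSmoothProjective D.isSmoothProjective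
      (rfl : 2 * (m + 1) + 2 * (2 * (m + 1)) = 2 * (m + 1) + 2 * (2 * (m + 1))) γ with hPdef
  set Q : complexBetti X (2 * (m + 1)) →ₗ[ℂ] complexBetti X (2 * (m + 1)) := P - LinearMap.id
    with hQdef
  have hQ : ∀ β, IsRationalClass β → IsRationalClass (Q β) := fun β hβ ↦ by
    rw [hQdef, LinearMap.sub_apply, LinearMap.id_apply]
    exact isRationalClass_sub (hrat β hβ) hβ
  have hcQ : Q c = 0 := by
    rw [hQdef, LinearMap.sub_apply, LinearMap.id_apply, hc, sub_self]
  have hspan := span_isRationalClass_eq_top_of_isSmoothProjective_holds (2 * (m + 1)) X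
    D.isSmoothProjective (2 * (m + 1))
  refine (span_le.2 ?_) (mem_span_rational_ker hspan Q hQ hcQ)
  rintro x ⟨hx, hQx⟩
  have hPx : P x = x := by
    rwa [hQdef, LinearMap.sub_apply, LinearMap.id_apply, sub_eq_zero] at hQx
  exact h μ hμ m X D h1 h2 γ hγ hrat hhodge x hx hPx

/-- **Under the crux the whole fixed subspace is algebraic**: `ker (P - 1) ≤ algebraicClasses X (m+1)`
for every admissible `P` — the honest (and cleaner) prover target. [cite: VoisinHodgeI2002, §7.1.1] -/
theorem ker_le_algebraicClasses_of_crux (h : IsotypicMiddleClassesAlgebraic)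
    (μ : OrientationFamily) (hμ : μ.HasPoincareDuality) (m : ℕ) (X : Motives.SchemeOver ℂ)
    (D : UnitaryBallQuotientDatum (2 * (m + 1)) X) (h1 : 1 ≤ m) (h2 : m ≤ 2)
    (γ : complexBetti (X ⊗ X) (2 * (2 * (m + 1)))) (hγ : γ ∈ algebraicClasses (X ⊗ X) (2 * (m + 1)))
    (hrat : ∀ β, IsRationalClass β → IsRationalClass
      (corrAction μ D.isSmoothProjective D.isSmoothProjective
        (rfl : 2 * (m + 1) + 2 * (2 * (m + 1)) = 2 * (m + 1) + 2 * (2 * (m + 1))) γ β))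
    (hhodge : ∀ β, IsOfHodgeType (2 * (m + 1)) X (2 * (m + 1)) (m + 1) (m + 1)
      (corrAction μ D.isSmoothProjective D.isSmoothProjective
        (rfl : 2 * (m + 1) + 2 * (2 * (m + 1)) = 2 * (m + 1) + 2 * (2 * (m + 1))) γ β)) :
    LinearMap.ker (corrAction μ D.isSmoothProjective D.isSmoothProjective
        (rfl : 2 * (m + 1) + 2 * (2 * (m + 1)) = 2 * (m + 1) + 2 * (2 * (m + 1))) γ - LinearMap.id) ≤
      algebraicClasses X (m + 1) := by
  intro c hc
  rw [LinearMap.mem_ker, LinearMap.sub_apply, LinearMap.id_apply, sub_eq_zero] at hc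
  exact mem_algebraicClasses_of_crux_of_fixed h μ hμ m X D h1 h2 γ hγ hrat hhodge c hc

end Summit.HodgeConjecture.HodgeConjecture.Theorems.IsotypicMiddleClassesAlgebraic.Negative.RationalFixed

end
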